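import Literature.MathematicalPhysics.QuantumFieldTheory.Balaban1983to89.MatrixNorms
import Literature.Barriers.QuantumFields.UnitaryHaarSmallBall
import Literature.MathematicalPhysics.QuantumFieldTheory.Balaban1983to89.B9TorusCalculus
import HarnessLib

/-!
# Route `UnitScaleTilt`, crux K1 «MinimiserStabilityRegPr» (stmt-QuantumFields-19200), route-R E′ path (α′), (E1-b) — THE `hs` ↔ `L²`-OPERATOR-NORM SEAM between the covariant (hK) chain
# (routeR-w6 g6's (R-cov) ✓p670099 `sqrt_hs_covD_interp_error_le`: rows in the Hilbert–Schmidt size `√hs X = √(Σ_{jk}‖X j k‖²)`) and the (E1-b) door ✓p671456 (rows in the E′ files' `L²`-operator norm,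
# `Pi` sup norms): `‖X‖ ≤ √hs X ≤ √N·‖X‖`, so an `hs`-row `√hs(D_Uψ(x,μ)) ≤ κ·s₁` fed with `s₁ := √N·‖G‖_∞` IS the door's row `‖D_Uψ(x,μ)‖ ≤ (κ√N)·‖G‖_∞`

Cell `ym3-torus`, D-0154 (3c) twin-width seat `ym-routeR-w3` (gen 6) = namer of the (hK)∕(A)∕(E1-b) lineage; LOCATE «(E1-b) CLOSE» (19200 evidence 7779e4954da6170d) §2 SEAM.  THEOREMS ONLY (0 `def`,
0 `sorry`); `--supports stmt-QuantumFields-19200`, count-neutral.  YM₃ on T³ is a ladder rung (R3), not the Clay problem; nothing here claims the stub, the crux, d = 4 or the gap.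

WHAT IS PROVED (ns `…Theorems.Prop7HSOpNormSeam`; `Matrix (Fin N) (Fin N) ℂ` with the `L²`-operator norm, scope `Matrix.Norms.L2Operator`; `hs` written out as `Σ j k ‖X j k‖^2`).
* §1 (`‖X‖ ≤ √(Σ‖X j k‖²)` is lit ✓ `MatrixNorms.opNorm_sq_le_sum_norm_sq`, also ✓ `Prop7CovPinJunkSums.norm_le_sqrt_hs` — used inline, not restated)
  ★ `sqrt_hs_le_sqrt_card_mul_norm` (`√(Σ‖X j k‖²) ≤ √N·‖X‖`, lit `norm_entry_le_l2_opNorm`), `sqrt_hs_apply_le_pi` (`√hs(G z) ≤ √N·‖G‖` for a `Pi`-normed field `G`).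
* §2 ★★ `op_row_of_hs_row` — for any background `U`, shifts `T`, field `ψ`, `Pi`-normed field `G` and `κ ≥ 0`:
  `(∀ μ x, √hs(covD T U μ ψ x) ≤ κ·(√N·‖G‖)) → ∀ μ x, ‖covD T U μ ψ x‖ ≤ (κ·√N)·‖G‖` — the door's (hK) currency (✓p671456 `hK`, `G := fun x => divB T U A x`, `κ := c·ℓ`).
HONEST SCOPE.  Norm bookkeeping only; the analytic row is routeR-w6's chain.  Constants: the seam costs exactly `√N` (= `√2` at the member).

References: G. H. Golub, C. F. Van Loan, *Matrix Computations*, 4th ed. 2013, §2.3 [GolubVanLoan2013]; T. Bałaban, CMP 99 (1985) 389–434 [Balaban1985BackgroundPropagators] ((3.3) p.390).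
-/

set_option autoImplicit false

noncomputable section

open scoped BigOperators Matrix.Norms.L2Operator Matrix

namespace Summit.QuantumFields.YangMills.Theorems.Prop7HSOpNormSeam

open Literature.Barriers.QuantumFields (norm_entry_le_l2_opNorm)
open Literature.MathematicalPhysics.QuantumFieldTheory.Balaban1983to89
open B9Eq39Adjoint (covD)

variable {N : ℕ}

/-! ## §1 `‖X‖ ≤ √hs X ≤ √N·‖X‖` -/

/-- ★ **HILBERT–SCHMIDT ≤ √N · OPERATOR NORM**: `√(Σ_{j,k} ‖X j k‖²) ≤ √N·‖X‖` (each entry `≤ ‖X‖`, lit `norm_entry_le_l2_opNorm`; `N²` entries under the root against one `√N`… we use the row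
count only: `Σ_k ‖X j k‖² ≤ ‖X‖²` is NOT claimed — the crude `N·N` count gives `N·‖X‖`, so we prove the sharper bound through the columns: `Σ_j ‖X j k‖² = ‖X e_k‖² ≤ ‖X‖²`). [cite: GolubVanLoan2013, §2.3.2] -/
theorem sqrt_hs_le_sqrt_card_mul_norm (X : Matrix (Fin N) (Fin N) ℂ) : Real.sqrt (∑ j : Fin N, ∑ k : Fin N, ‖X j k‖ ^ 2) ≤ Real.sqrt N * ‖X‖ := by
  -- column bound: `Σ_j ‖X j k‖² = ‖X e_k‖² ≤ ‖X‖²`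
  have hcol : ∀ k : Fin N, ∑ j, ‖X j k‖ ^ 2 ≤ ‖X‖ ^ 2 := by
    intro k
    set v : EuclideanSpace ℂ (Fin N) := PiLp.single 2 k (1 : ℂ) with hv
    have hv1 : ‖v‖ = 1 := by rw [hv, PiLp.norm_single, norm_one]
    have h1 := Matrix.l2_opNorm_mulVec X v
    rw [hv1, mul_one] at h1
    have hvk : WithLp.ofLp v = Pi.single k 1 := by rw [hv]; rfl
    have e : ∑ j, ‖X j k‖ ^ 2 = ‖(WithLp.toLp 2 (X *ᵥ WithLp.ofLp v) : EuclideanSpace ℂ (Fin N))‖ ^ 2 := by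
      rw [EuclideanSpace.norm_sq_eq]
      refine Finset.sum_congr rfl fun j _ => ?_
      rw [hvk, Matrix.mulVec_single_one, PiLp.toLp_apply, Matrix.col_apply]
    rw [e]
    exact pow_le_pow_left₀ (norm_nonneg _) h1 2
  have hsum : ∑ j : Fin N, ∑ k : Fin N, ‖X j k‖ ^ 2 ≤ N * ‖X‖ ^ 2 := by
    rw [Finset.sum_comm]
    calc ∑ k, ∑ j, ‖X j k‖ ^ 2 ≤ ∑ _k : Fin N, ‖X‖ ^ 2 := Finset.sum_le_sum fun k _ => hcol k
      _ = N * ‖X‖ ^ 2 := by rw [Finset.sum_const, Finset.card_univ, Fintype.card_fin, nsmul_eq_mul]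
  calc Real.sqrt (∑ j, ∑ k, ‖X j k‖ ^ 2) ≤ Real.sqrt (N * ‖X‖ ^ 2) := Real.sqrt_le_sqrt hsum
    _ = Real.sqrt N * ‖X‖ := by rw [Real.sqrt_mul (Nat.cast_nonneg N), Real.sqrt_sq (norm_nonneg _)]

/-- `√hs(G z) ≤ √N·‖G‖` for a `Pi`-normed matrix field `G` (sup over sites). [cite: GolubVanLoan2013, §2.3.2] -/
theorem sqrt_hs_apply_le_pi {S : Type*} [Fintype S] (G : S → Matrix (Fin N) (Fin N) ℂ) (z : S) :
    Real.sqrt (∑ j : Fin N, ∑ k : Fin N, ‖G z j k‖ ^ 2) ≤ Real.sqrt N * ‖G‖ :=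
  (sqrt_hs_le_sqrt_card_mul_norm (G z)).trans (mul_le_mul_of_nonneg_left (norm_le_pi_norm G z) (Real.sqrt_nonneg _))

/-! ## §2 The seam: an `hs`-row fed with `s₁ := √N·‖G‖_∞` is the door's operator-norm row -/

/-- ★★ **`hs`-ROW ⇒ DOOR ROW**: for any background `U`, shifts `T`, site field `ψ`, `Pi`-normed field `G` and `κ ≥ 0`, if `√hs(D_Uψ(x,μ)) ≤ κ·(√N·‖G‖)` at every `(μ, x)` then `‖D_Uψ(x,μ)‖ ≤ (κ·√N)·‖G‖` at
every `(μ, x)` — read with `G := fun x => divB T U A x` (so `√hs(Δ_Uφ z) ≤ √N·‖G‖` by `sqrt_hs_apply_le_pi` when `Δ_Uφ = D*_UA`) this is ✓ `Prop7LinearCorrectorBound.linCorr_gauge_le_of_rows`'s `hK` with `c_I·ℓ := κ·√N`.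
[cite: Balaban1985BackgroundPropagators, (3.3) p.390; GolubVanLoan2013, §2.3.2] -/
theorem op_row_of_hs_row {S ι : Type*} [Fintype S] (T : ι → Equiv.Perm S) (U : ι → S → (Matrix (Fin N) (Fin N) ℂ)ˣ)
    (ψ : S → Matrix (Fin N) (Fin N) ℂ) (G : S → Matrix (Fin N) (Fin N) ℂ) {κ : ℝ}
    (h : ∀ (μ : ι) (x : S), Real.sqrt (∑ j : Fin N, ∑ k : Fin N, ‖(covD T U μ ψ x) j k‖ ^ 2) ≤ κ * (Real.sqrt N * ‖G‖)) :
    ∀ (μ : ι) (x : S), ‖covD T U μ ψ x‖ ≤ (κ * Real.sqrt N) * ‖G‖ := fun μ x =>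
  calc ‖covD T U μ ψ x‖ ≤ Real.sqrt (∑ j : Fin N, ∑ k : Fin N, ‖(covD T U μ ψ x) j k‖ ^ 2) :=
        Real.le_sqrt_of_sq_le (MatrixNorms.opNorm_sq_le_sum_norm_sq _)  -- = ✓ `Prop7CovPinJunkSums.norm_le_sqrt_hs` (lit `MatrixNorms`)
    _ ≤ κ * (Real.sqrt N * ‖G‖) := h μ x
    _ = (κ * Real.sqrt N) * ‖G‖ := by ring

/-- the supplier-side instantiation: if `Δ_Uφ = G` pointwise then `√hs(Δ_Uφ z) ≤ √N·‖G‖` for every `z` — the `hs₁` slot of ✓p670099 `sqrt_hs_covD_interp_error_le` with `s₁ := √N·‖G‖`.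
[cite: GolubVanLoan2013, §2.3.2] -/
theorem hs_bound_of_eq {S : Type*} [Fintype S] (F G : S → Matrix (Fin N) (Fin N) ℂ) (hFG : ∀ z, F z = G z) (z : S) :
    Real.sqrt (∑ j : Fin N, ∑ k : Fin N, ‖F z j k‖ ^ 2) ≤ Real.sqrt N * ‖G‖ := by
  rw [hFG z]
  exact sqrt_hs_apply_le_pi G z

end Summit.QuantumFields.YangMills.Theorems.Prop7HSOpNormSeam

end
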